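import Literature.AnabelianGeometry.EtaleTheta.SettingModelChiSemidirect
import Literature.AnabelianGeometry.EtaleTheta.SettingModelActionContinuity
import Literature.AnabelianGeometry.EtaleTheta.SettingModelKummerCocycleContinuous
import Literature.AnabelianGeometry.EtaleTheta.SettingModelGfpActionTempered
import HarnessLib

/-!
# The STAGE-2 («Tate shear») model of the [EtTh] §1 root, part F4q:
# `Π^tp_X := (F̂₂ ×_Ẑ ℤ) ⋊_{(κ_p^i, κ_p^j, χ)} G_{ℚ_p}` as a tempered curve

Mochizuki, *The étale theta function …*, Publ. RIMS **45** (2009) [EtTh], §1, PRIMS PDF pp. 11–13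
[cite: MochizukiEtTh2009, §1 p.12]: "`Π^tp_X`", the extension `1 → Δ^tp_X → Π^tp_X → G_K → 1`,
"`Π_X := (Π^tp_X)^∧`", "`Δ_X` … a profinite free group on 2 generators"; p. 13: "`K_N := K(ζ_N, q_X^{1/N})`",
"`G_{K_N}` acts trivially on `(Δ^tp_X)^ell/N·(Δ^tp_Y)^ell`" (the Galois action on `(Δ^tp_X)^ell` is upper
triangular: cyclotomic character on `Ẑ(1)·b`, Kummer cocycle of the `q`-parameter in the corner).  abc-iut cell,
layer L2, R78 cluster STAGE 2 (integrator abc-iut-L6-d6, R78-MAP #5), hand **F4q** = seat abc-iut-w5-d249 (gen 5):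
the stage-1 file F4β (`SettingModelChiSemidirect.lean`, `PiTpχ p := Γ ⋊_{actχ} G_{ℚ_p}`) VERBATIM with the
diagonal action `actχ = twistGfp ∘ χ` replaced by the AFFINE action
`actχq p i j := affTwist₃Gfp ∘ (σ ↦ ⟨((κ_p σ)^i, (κ_p σ)^j), χ σ⟩)` — `a ↦ Inn(b^{κ_p(σ)^i}) (a · b^{κ_p(σ)^j})`,
`b ↦ b^{χ(σ)}` (abc-iut-L2-t6's F2c `affTwist₃`/`affTwist₃Gfp`, abc-iut-L2-t5's F3c-2 `cocyclePairHom`/`kappaP`,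
abc-iut-w5-d091's `chi` — consumed BY NAME, nothing restated).  GENERIC in the exponents `(i j : ℤ)`: the
designated instantiation (abc-iut-L2-t12's class-two normal form "`[m] = −κ(q̈)`, `[k] = 2κ(q̈) = κ(q_X)`") is
`(i, j) = (−1, 2)`, the opposite deck orientation `(1, −2)`; every statement holds for all `(i, j)`.  Joint
continuity comes from this seat's proof-only `SettingModelActionContinuity.lean`
(`continuous_affTwist₃Gfp_of_continuous`, at the continuous coordinates `κ_p^i`, `κ_p^j`
(`continuous_kappaP_zpow`) and `σ ↦ χ(σ)(1)` (`continuous_chi_apply_iotaZ_one`)), so: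

* `PiTpχq p i j := Γ ⋊_{actχq} G_{ℚ_p}` with the topology INDUCED along `g ↦ (g.left, g.right)`, a topological
  group (`continuous_actχq`), TEMPERED (`isTempered_PiTpχq`, by abc-iut-w5-d111's action-generic
  `isTempered_gfp_semidirect_of_action`); `augχq := right` — continuous, OPEN, onto `G_{ℚ_p}`;
* `PiHtχq p i j := F̂₂ ⋊_{actHatχq} G_{ℚ_p}` — compact, Hausdorff, totally disconnected topological group;
  `toHatχq := pr₁ ⋊ id` — continuous, injective, a PROFINITE COMPLETION (`isProfiniteCompletion_toHatχq`);
* `curveχq p i j : TemperedCurve p` — `K := ℚ_p`, no closed points (as F4β's `curveχ`); `deltaHatχq_eq`,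
  `deltaHatχqEquiv : F̂₂ ≃ₜ* Δ_X`, `isFreeProfiniteOnTwo_deltaHatχq`;
* the two level laws the stage-2 covering tower reads (abc-iut-L6-d6's (h1)/(h2), R78-MAP #5 kernel warning:
  NO global `Heis(ℤ/N)`-descent is claimed): `hHat_gfpFst_actχq_of_gfpSnd_eq_one` (on degree `0` the action IS
  the diagonal twist `diagTwist (χ_N σ)`) and `hHat_gfpFst_actχq_of_level` (`χ_N σ = 1 ∧ κ_p σ ≡ 0 (N)` ⇒
  level-`N`-trivial on all of `Γ`), with the open set `isOpen_setOf_actχq_level_trivial`.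

HONEST LABEL: a semi-synthetic model — consistency evidence for the typed interface, NOT the tempered `π₁` of a
curve; nothing of [EtTh] is asserted; nothing here bears on [IUTchIII] Cor. 3.12.  Class (b) MODEL/CONSTRUCTION
file (def-bearing, instances only on the NEW carriers `PiTpχq`, `PiHtχq`).
-/

noncomputable section

namespace Literature.AnabelianGeometry.EtaleTheta.SettingModel

open Literature.AnabelianGeometry.SemiGraphs _root_.Topology _root_.Function
open CategoryTheory ProfiniteGrp ProfiniteGrp.ProfiniteCompletion

/-! ### Continuity of `σ ↦ c(σ)(1)` from the level characters -/

/-- **`σ ↦ c(σ)(1) ∈ Ẑ` is continuous** for any `c : G → Aut(Ẑ)` whose level characters `χ_N ∘ c` are locally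
constant (`level_N (c σ 1) = χ_N(c σ)`; abc-iut-w5-d171's `ZHatLevel.continuous_of_isLocallyConstant_level`).
[cite: MochizukiEtTh2009, §1 p.12] -/
theorem continuous_apply_iotaZ_one_of_isLocallyConstant {G : Type*} [TopologicalSpace G] (c : G → MulAut ZH)
    (hc : ∀ N : ℕ+, IsLocallyConstant fun σ => ZHatLevel.levelChar N (c σ)) :
    Continuous fun σ => c σ (iotaZ (Multiplicative.ofAdd 1)) := by
  refine ZHatLevel.continuous_of_isLocallyConstant_level _ fun N => ?_
  have hfun : (fun σ => ZHatLevel.level N (c σ (iotaZ (Multiplicative.ofAdd 1)))) =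
      fun σ => Multiplicative.ofAdd (ZHatLevel.levelChar N (c σ)) := by
    funext σ
    rw [ZHatLevel.levelChar_apply, ofAdd_toAdd, iotaZ_one_eq]
  rw [hfun]
  exact (hc N).comp _

variable (p : ℕ) [Fact p.Prime] (i j : ℤ)

/-! ### The stage-2 action `σ ↦ Inn(b^{κ_p^i}) ∘ shear(κ_p^j) ∘ θ_χ` of `G_{ℚ_p}` on `F̂₂` and on `Γ` -/

/-- **`G_{ℚ_p} → (Ẑ × Ẑ) ⋊_{diag} Ẑ^×`, `σ ↦ ⟨((κ_p σ)^i, (κ_p σ)^j), χ σ⟩`** — abc-iut-L2-t5's `cocyclePairHom` at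
abc-iut-L2-t6's `diagAut` (designated `(i, j) = (−1, 2)`). [cite: MochizukiEtTh2009, §1 p.13] -/
abbrev tatePairHom : GQp p →* (ZH × ZH) ⋊[diagAut] MulAut ZH := cocyclePairHom p diagAut diagAut_apply i j

/-- **The stage-2 action of `G_{ℚ_p}` on `F̂₂`**: `σ ↦ Inn(b^{κ_p(σ)^i}) ∘ shear (κ_p(σ)^j) ∘ θ_{χ(σ)}`.
[cite: MochizukiEtTh2009, §1 p.13] -/
abbrev actHatχq : GQp p →* MulAut F₂hatT := affTwist₃.comp (tatePairHom p i j)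

/-- [cite: MochizukiEtTh2009, §1 p.13] -/
theorem actHatχq_apply (σ : GQp p) (x : F₂hatT) :
    actHatχq p i j σ x = affTwist₃ ⟨(kappaP p σ ^ i, kappaP p σ ^ j), chi p σ⟩ x := rfl

/-- **The stage-2 action of `G_{ℚ_p}` on `Γ = F̂₂ ×_Ẑ ℤ`** (`affTwist₃Gfp ∘ tatePairHom`): the replacement of F4β's
`actχ`. [cite: MochizukiEtTh2009, §1 p.13] -/
abbrev actχq : GQp p →* MulAut Gfp := affTwist₃Gfp.comp (tatePairHom p i j)

/-- [cite: MochizukiEtTh2009, §1 p.13] -/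
theorem actχq_apply (σ : GQp p) (γ : Gfp) :
    actχq p i j σ γ = affTwist₃Gfp ⟨(kappaP p σ ^ i, kappaP p σ ^ j), chi p σ⟩ γ := rfl

/-- `pr₁ : Γ → F̂₂` intertwines the two actions. [cite: MochizukiEtTh2009, §1 p.13] -/
theorem gfpFst_actχq (σ : GQp p) (γ : Gfp) : gfpFst (actχq p i j σ γ) = actHatχq p i j σ (gfpFst γ) := rfl

/-- The stage-2 action preserves the degree `Γ ↠ ℤ`. [cite: MochizukiEtTh2009, §1 p.13] -/
theorem gfpSnd_actχq (σ : GQp p) (γ : Gfp) : gfpSnd (actχq p i j σ γ) = gfpSnd γ := rfl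

/-- `ê` is invariant under the stage-2 action. [cite: MochizukiEtTh2009, §1 p.13] -/
theorem eHat_actHatχq (σ : GQp p) (x : F₂hatT) : eHat (actHatχq p i j σ x) = eHat x := eHat_affTwist₃ _ x

/-- Each `actHatχq σ` is continuous. [cite: MochizukiEtTh2009, §1 p.13] -/
theorem continuous_actHatχq_apply (σ : GQp p) : Continuous (actHatχq p i j σ : F₂hatT → F₂hatT) :=
  continuous_affTwist₃ _

/-- Each `actχq σ` is continuous. [cite: MochizukiEtTh2009, §1 p.13] -/
theorem continuous_actχq_apply (σ : GQp p) : Continuous (actχq p i j σ : Gfp → Gfp) :=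
  continuous_affTwist₃Gfp _

/-- `σ ↦ χ(σ)(1) ∈ Ẑ` is continuous on `G_{ℚ_p}` (Krull topology). [cite: NeukirchANT1999, Ch. IV §1] -/
theorem continuous_chi_apply_iotaZ_one :
    Continuous fun σ : GQp p => chi p σ (iotaZ (Multiplicative.ofAdd 1)) :=
  continuous_apply_iotaZ_one_of_isLocallyConstant (fun σ => chi p σ) (isLocallyConstant_levelChar_chi p)

/-- **The stage-2 action on `F̂₂` is jointly continuous** (`continuous_affTwist₃_of_continuous` at the continuous
coordinates `κ_p^i`, `κ_p^j`, `χ(·)(1)`). [cite: MochizukiEtTh2009, §1 p.13] -/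
theorem continuous_actHatχq : Continuous fun q : GQp p × F₂hatT => actHatχq p i j q.1 q.2 :=
  continuous_affTwist₃_of_continuous (fun σ => tatePairHom p i j σ) (continuous_kappaP_zpow p i)
    (continuous_kappaP_zpow p j) (continuous_chi_apply_iotaZ_one p)

/-- **The stage-2 action on `Γ` is jointly continuous** (the input making `Γ ⋊ G_{ℚ_p}` a topological group).
[cite: MochizukiEtTh2009, §1 p.13] -/
theorem continuous_actχq : Continuous fun q : GQp p × Gfp => actχq p i j q.1 q.2 :=
  continuous_affTwist₃Gfp_of_continuous (fun σ => tatePairHom p i j σ) (continuous_kappaP_zpow p i)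
    (continuous_kappaP_zpow p j) (continuous_chi_apply_iotaZ_one p)

/-! ### The two level laws of the stage-2 action (no global `Heis(ℤ/N)`-descent is claimed) -/

/-- **(h1) On degree `0` the stage-2 action IS the diagonal twist**: for `γ ∈ Γ` with `pr₂ γ = 1`,
`ĥ_N (pr₁ (σ·γ)) = diagTwist (χ_N σ) (ĥ_N (pr₁ γ))` (abc-iut-L2-t6's `hHat_gfpFst_affTwist₃Gfp_of_gfpSnd_eq_one`) —
so `Y_N`/`Z_N` stability and indices transfer verbatim from stage 1. [cite: MochizukiEtTh2009, §1 p.13] -/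
theorem hHat_gfpFst_actχq_of_gfpSnd_eq_one (N : ℕ+) (σ : GQp p) {γ : Gfp} (hγ : gfpSnd γ = 1) :
    hHat N (gfpFst (actχq p i j σ γ)) =
      Heis.diagTwist (ZHatLevel.levelChar N (chi p σ)) (hHat N (gfpFst γ)) :=
  hHat_gfpFst_affTwist₃Gfp_of_gfpSnd_eq_one N _ _ _ hγ

/-- **(h2) Level-`N` triviality on the congruence set**: if `χ_N(σ) = 1` and `κ_p(σ) ≡ 0 (N)` then
`ĥ_N (pr₁ (σ·γ)) = ĥ_N (pr₁ γ)` for EVERY `γ ∈ Γ` (abc-iut-L2-t6's `hHat_affTwist₃_of_level`; both exponent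
coordinates are then `≡ 0`). [cite: MochizukiEtTh2009, §1 p.13] -/
theorem hHat_gfpFst_actχq_of_level (N : ℕ+) {σ : GQp p} (hχ : ZHatLevel.levelChar N (chi p σ) = 1)
    (hκ : ZHatLevel.level N (kappaP p σ) = 1) (γ : Gfp) :
    hHat N (gfpFst (actχq p i j σ γ)) = hHat N (gfpFst γ) := by
  have hi : ZHatLevel.level N (kappaP p σ ^ i) = 1 := by rw [map_zpow, hκ, one_zpow]
  have hj : ZHatLevel.level N (kappaP p σ ^ j) = 1 := by rw [map_zpow, hκ, one_zpow]
  exact hHat_affTwist₃_of_level N hi hj hχ _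

/-- The same on `F̂₂`. [cite: MochizukiEtTh2009, §1 p.13] -/
theorem hHat_actHatχq_of_level (N : ℕ+) {σ : GQp p} (hχ : ZHatLevel.levelChar N (chi p σ) = 1)
    (hκ : ZHatLevel.level N (kappaP p σ) = 1) (x : F₂hatT) :
    hHat N (actHatχq p i j σ x) = hHat N x := by
  have hi : ZHatLevel.level N (kappaP p σ ^ i) = 1 := by rw [map_zpow, hκ, one_zpow]
  have hj : ZHatLevel.level N (kappaP p σ ^ j) = 1 := by rw [map_zpow, hκ, one_zpow]
  exact hHat_affTwist₃_of_level N hi hj hχ x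

/-- The congruence set `{σ | χ_N σ = 1 ∧ κ_p σ ≡ 0 (N)}` (⊇ `G_{ℚ_p(μ_N, p^{1/N})}`) is open and contains `1`
(abc-iut-L2-t5's `isOpen_setOf_levelChar_eq_one_and_level_kappaP_eq_one`). [cite: NeukirchANT1999, Ch. IV §1] -/
theorem isOpen_setOf_actχq_level_trivial (N : ℕ+) :
    IsOpen {σ : GQp p | ZHatLevel.levelChar N (chi p σ) = 1 ∧ ZHatLevel.level N (kappaP p σ) = 1} ∧
      (1 : GQp p) ∈ {σ : GQp p | ZHatLevel.levelChar N (chi p σ) = 1 ∧ ZHatLevel.level N (kappaP p σ) = 1} :=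
  ⟨isOpen_setOf_levelChar_eq_one_and_level_kappaP_eq_one p N, by
    rw [Set.mem_setOf_eq, map_one, map_one, kappaP_one, map_one]; exact ⟨rfl, rfl⟩⟩

/-! ### `Π^tp_X := Γ ⋊_{actχq} G_{ℚ_p}` -/

/-- **`Π^tp_X` of the stage-2 model**: `Γ ⋊_{actχq} G_{ℚ_p}`. [cite: MochizukiEtTh2009, §1 p.12] -/
abbrev PiTpχq : Type := Gfp ⋊[actχq p i j] GQp p

/-- The topology of `Π^tp_X`: induced along `g ↦ (g.left, g.right) ∈ Γ × G_{ℚ_p}`. [cite: MochizukiEtTh2009, §1 p.12] -/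
instance instTopologicalSpacePiTpχq : TopologicalSpace (PiTpχq p i j) :=
  TopologicalSpace.induced (fun g : PiTpχq p i j => (g.left, g.right)) inferInstance

/-- `g ↦ (g.left, g.right)` is inducing. [cite: MochizukiEtTh2009, §1 p.12] -/
theorem isInducing_leftRightχq : IsInducing fun g : PiTpχq p i j => (g.left, g.right) := ⟨rfl⟩

/-- `g ↦ (g.left, g.right)` is continuous. [cite: MochizukiEtTh2009, §1 p.12] -/
theorem continuous_leftRightχq : Continuous fun g : PiTpχq p i j => (g.left, g.right) :=
  (isInducing_leftRightχq p i j).continuous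

/-- **`Π^tp_X` is a topological group** (joint continuity `continuous_actχq`). [cite: MochizukiEtTh2009, §1 p.12] -/
instance instIsTopologicalGroupPiTpχq : IsTopologicalGroup (PiTpχq p i j) :=
  Semidirect.isTopologicalGroup_of_continuous_action (isInducing_leftRightχq p i j) (continuous_actχq p i j)

/-- `Γ ↪ Π^tp_X` is continuous. [cite: MochizukiEtTh2009, §1 p.12] -/
theorem continuous_inlχq : Continuous (SemidirectProduct.inl : Gfp → PiTpχq p i j) :=
  Semidirect.continuous_inl (isInducing_leftRightχq p i j)

/-- The section `G_{ℚ_p} ↪ Π^tp_X` is continuous. [cite: MochizukiEtTh2009, §1 p.12] -/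
theorem continuous_inrχq : Continuous (SemidirectProduct.inr : GQp p → PiTpχq p i j) :=
  Semidirect.continuous_inr (isInducing_leftRightχq p i j)

/-- **The augmentation `Π^tp_X → G_{ℚ_p}`**: `g ↦ g.right`. [cite: MochizukiEtTh2009, §1 p.12] -/
def augχq : PiTpχq p i j →ₜ* GQp p := Semidirect.rightHomCont (isInducing_leftRightχq p i j)

/-- [cite: MochizukiEtTh2009, §1 p.12] -/
@[simp] theorem augχq_apply (g : PiTpχq p i j) : augχq p i j g = g.right := rfl

/-- **The augmentation is an OPEN map.** [cite: MochizukiEtTh2009, §1 p.12] -/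
theorem isOpenMap_augχq : IsOpenMap (augχq p i j) := Semidirect.isOpenMap_right (isInducing_leftRightχq p i j)

/-- The augmentation is onto `G_{ℚ_p} = G_K` (`K = ℚ_p`). [cite: MochizukiEtTh2009, §1 p.12] -/
theorem range_augχq : (augχq p i j).toMonoidHom.range = ⊤ :=
  MonoidHom.range_eq_top.mpr fun σ => ⟨SemidirectProduct.inr σ, rfl⟩

/-- `actχq` on coordinates: `(actHatχq σ × id)|_Γ` (the shape of abc-iut-w5-d111's hypothesis `hφ`).
[cite: MochizukiEtTh2009, §1 p.13] -/
theorem coe_actχq (σ : GQp p) (γ : Gfp) :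
    ((actχq p i j σ γ : Gfp) : F₂hatT × Multiplicative ℤ) =
      (actHatχq p i j σ (γ : F₂hatT × Multiplicative ℤ).1, (γ : F₂hatT × Multiplicative ℤ).2) := rfl

/-- The orbit maps `σ ↦ σ·x` of the stage-2 action on `F̂₂` are continuous (from joint continuity).
[cite: MochizukiEtTh2009, §1 p.13] -/
theorem continuous_actHatχq_left (x : F₂hatT) : Continuous fun σ : GQp p => actHatχq p i j σ x :=
  (continuous_actHatχq p i j).comp (f := fun σ : GQp p => (σ, x)) (continuous_id.prodMk continuous_const)

/-- **`Π^tp_X` of the stage-2 model is TEMPERED** (abc-iut-w5-d111's action-generic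
`isTempered_gfp_semidirect_of_action`: a characteristic open subgroup of `F̂₂` is stable under every `actHatχq σ`,
so no level formula for the shear is needed). [cite: MochizukiEtTh2009, §1 p.12] -/
theorem isTempered_PiTpχq : IsTempered (PiTpχq p i j) := by
  haveI := compactSpace_GQp p
  haveI : T2Space (GQp p) := krullTopology_t2
  haveI := totallyDisconnectedSpace_GQp p
  exact isTempered_gfp_semidirect_of_action (actHatχq p i j) (continuous_actHatχq_apply p i j)
    (continuous_actHatχq_left p i j) (coe_actχq p i j) (isInducing_leftRightχq p i j)

/-! ### `Π_X := F̂₂ ⋊ G_{ℚ_p}` and the completion map -/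

/-- **`Π_X` of the stage-2 model**: `F̂₂ ⋊_{actHatχq} G_{ℚ_p}`. [cite: MochizukiEtTh2009, §1 p.12] -/
abbrev PiHtχq : Type := F₂hatT ⋊[actHatχq p i j] GQp p

/-- The topology of `Π_X`: induced along `g ↦ (g.left, g.right)`. [cite: MochizukiEtTh2009, §1 p.12] -/
instance instTopologicalSpacePiHtχq : TopologicalSpace (PiHtχq p i j) :=
  TopologicalSpace.induced (fun g : PiHtχq p i j => (g.left, g.right)) inferInstance

/-- [cite: MochizukiEtTh2009, §1 p.12] -/
theorem isInducing_leftRightHatχq : IsInducing fun g : PiHtχq p i j => (g.left, g.right) := ⟨rfl⟩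

/-- [cite: MochizukiEtTh2009, §1 p.12] -/
theorem continuous_leftRightHatq : Continuous fun g : PiHtχq p i j => (g.left, g.right) :=
  (isInducing_leftRightHatχq p i j).continuous

/-- `Π_X` is a topological group. [cite: MochizukiEtTh2009, §1 p.12] -/
instance instIsTopologicalGroupPiHtχq : IsTopologicalGroup (PiHtχq p i j) :=
  Semidirect.isTopologicalGroup_of_continuous_action (isInducing_leftRightHatχq p i j) (continuous_actHatχq p i j)

/-- `Π_X` is compact. [cite: MochizukiEtTh2009, §1 p.12] -/
instance instCompactSpacePiHtχq : CompactSpace (PiHtχq p i j) := by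
  haveI := compactSpace_GQp p
  exact Semidirect.compactSpace_of (isInducing_leftRightHatχq p i j)

/-- `Π_X` is Hausdorff. [cite: MochizukiEtTh2009, §1 p.12] -/
instance instT2SpacePiHtχq : T2Space (PiHtχq p i j) := by
  haveI : T2Space (GQp p) := krullTopology_t2
  exact Semidirect.t2Space_of (isInducing_leftRightHatχq p i j)

/-- `Π_X` is totally disconnected. [cite: MochizukiEtTh2009, §1 p.12] -/
instance instTotallyDisconnectedSpacePiHtχq : TotallyDisconnectedSpace (PiHtχq p i j) := by
  haveI := totallyDisconnectedSpace_GQp p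
  exact Semidirect.totallyDisconnectedSpace_of (isInducing_leftRightHatχq p i j)

/-- **`Π^tp_X → Π_X`**: `pr₁ ⋊ id`. [cite: MochizukiEtTh2009, §1 p.12] -/
def toHatχq : PiTpχq p i j →ₜ* PiHtχq p i j :=
  Semidirect.mapCont (isInducing_leftRightχq p i j) (isInducing_leftRightHatχq p i j) gfpFst (gfpFst_actχq p i j)

/-- [cite: MochizukiEtTh2009, §1 p.12] -/
@[simp] theorem toHatχq_left (g : PiTpχq p i j) : (toHatχq p i j g).left = gfpFst g.left := rfl

/-- [cite: MochizukiEtTh2009, §1 p.12] -/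
@[simp] theorem toHatχq_right (g : PiTpχq p i j) : (toHatχq p i j g).right = g.right := rfl

/-- `Π^tp_X → Π_X` is injective ("natural injection"). [cite: MochizukiEtTh2009, §1 p.12] -/
theorem toHatχq_injective : Injective (toHatχq p i j) :=
  Semidirect.mapCont_injective _ _ _ _ gfpFst_injective

/-- The profinite augmentation `Π_X → G_{ℚ_p}`: `g ↦ g.right`. [cite: MochizukiEtTh2009, §1 p.12] -/
def augHatχq : PiHtχq p i j →ₜ* GQp p := Semidirect.rightHomCont (isInducing_leftRightHatχq p i j)

/-- [cite: MochizukiEtTh2009, §1 p.12] -/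
@[simp] theorem augHatχq_apply (g : PiHtχq p i j) : augHatχq p i j g = g.right := rfl

/-- `augHat ∘ toHat = aug`. [cite: MochizukiEtTh2009, §1 p.12] -/
theorem augHatχq_toHatχq (g : PiTpχq p i j) : augHatχq p i j (toHatχq p i j g) = augχq p i j g := rfl

/-- **`Π_X = (Π^tp_X)^∧`**: `pr₁ ⋊ id` is a profinite completion (generic `isProfiniteCompletion_mapCont`; each
`actHatχq σ` is continuous). [cite: MochizukiEtTh2009, §1 p.12] -/
theorem isProfiniteCompletion_toHatχq : IsProfiniteCompletion (toHatχq p i j) := by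
  haveI := compactSpace_GQp p
  haveI : T2Space (GQp p) := krullTopology_t2
  haveI := totallyDisconnectedSpace_GQp p
  exact Semidirect.isProfiniteCompletion_mapCont (isInducing_leftRightχq p i j) (isInducing_leftRightHatχq p i j)
    gfpFst (gfpFst_actχq p i j) isProfiniteCompletion_gfpFst (continuous_actHatχq_apply p i j)

/-! ### The tempered-curve layer -/

/-- **The tempered-curve layer of the stage-2 model**: `K := ℚ_p`, `Π^tp := Γ ⋊ G_{ℚ_p}`, `Π := F̂₂ ⋊ G_{ℚ_p}`
(stage-2 action), no closed points (as F4β's `curveχ`). [cite: MochizukiEtTh2009, §1 p.11] -/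
abbrev curveχq : TemperedCurve p where
  K := ⊥
  finiteDimensional_K := inferInstance
  PiTemp := PiTpχq p i j
  aug := augχq p i j
  range_aug := by
    rw [IntermediateField.fixingSubgroup_bot]
    exact range_augχq p i j
  PiHat := PiHtχq p i j
  toHat := toHatχq p i j
  isProfiniteCompletion_toHat := isProfiniteCompletion_toHatχq p i j
  toHat_injective := toHatχq_injective p i j
  augHat := augHatχq p i j
  augHat_comp _ := rfl
  Pt := PEmpty
  IsCusp _ := False
  decomp x := x.elim
  isClosed_decomp x := x.elim
  isOpen_aug_decomp x := x.elim
  inertia_eq_bot x := x.elim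
  inertia_equiv_zHat x := x.elim

/-- `Π^tp` of `curveχq` is tempered (= `isTempered_PiTpχq`). [cite: MochizukiEtTh2009, §1 p.12] -/
theorem isTempered_piTemp_curveχq : IsTempered (curveχq p i j).PiTemp := isTempered_PiTpχq p i j

/-- `Δ^tp_X = Ker(aug) = {g | g.right = 1} = Γ ⋊ 1`. [cite: MochizukiEtTh2009, §1 p.12] -/
theorem mem_deltaTempχq_iff (g : PiTpχq p i j) : g ∈ (curveχq p i j).DeltaTemp ↔ g.right = 1 := Iff.rfl

/-- `inl γ ∈ Δ^tp_X`. [cite: MochizukiEtTh2009, §1 p.12] -/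
theorem inl_mem_deltaTempχq (γ : Gfp) : (SemidirectProduct.inl γ : PiTpχq p i j) ∈ (curveχq p i j).DeltaTemp :=
  (mem_deltaTempχq_iff p i j _).mpr rfl

/-- `Ker(Π_X → G_{ℚ_p})` is closed. [cite: MochizukiEtTh2009, §1 p.12] -/
theorem isClosed_ker_rightHomHatχq :
    IsClosed ((SemidirectProduct.rightHom : PiHtχq p i j →* GQp p).ker : Set (PiHtχq p i j)) := by
  haveI : T2Space (GQp p) := krullTopology_t2
  have e : ((SemidirectProduct.rightHom : PiHtχq p i j →* GQp p).ker : Set (PiHtχq p i j)) =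
      (fun g : PiHtχq p i j => g.right) ⁻¹' {1} := by
    ext g; simp [MonoidHom.mem_ker, SemidirectProduct.rightHom]
  rw [e]
  exact isClosed_singleton.preimage (Semidirect.continuous_right (isInducing_leftRightHatχq p i j))

/-- **`Δ_X = F̂₂ ⋊ 1 = Ker(Π_X → G_{ℚ_p})`** (the image of `Γ` in `F̂₂` is dense). [cite: MochizukiEtTh2009, §1 p.12] -/
theorem deltaHatχq_eq :
    (curveχq p i j).DeltaHat = (SemidirectProduct.rightHom : PiHtχq p i j →* GQp p).ker := by
  apply le_antisymm
  · refine Subgroup.topologicalClosure_minimal _ ?_ (isClosed_ker_rightHomHatχq p i j)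
    rintro _ ⟨g, hg, rfl⟩
    rw [MonoidHom.mem_ker]
    change ((curveχq p i j).toHat g).right = 1
    exact (mem_deltaTempχq_iff p i j g).mp hg
  · intro x hx
    rw [MonoidHom.mem_ker] at hx
    change x.right = 1 at hx
    -- `x = inl x.left`, and `inl x.left ∈ closure (inl '' range pr₁) ⊆ closure (toHat '' Δ^tp)`
    have hxe : x = SemidirectProduct.inl x.left := by
      rw [← SemidirectProduct.inl_left_mul_inr_right x, hx, map_one, mul_one]
      rfl
    have hsub : SemidirectProduct.inl '' Set.range (gfpFst : Gfp → F₂hatT) ⊆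
        (((curveχq p i j).DeltaTemp.map (curveχq p i j).toHat.toMonoidHom : Subgroup (PiHtχq p i j)) :
          Set (PiHtχq p i j)) := by
      rintro _ ⟨_, ⟨γ, rfl⟩, rfl⟩
      refine ⟨SemidirectProduct.inl γ, inl_mem_deltaTempχq p i j γ, ?_⟩
      change toHatχq p i j (SemidirectProduct.inl γ) = SemidirectProduct.inl (gfpFst γ)
      exact SemidirectProduct.ext rfl rfl
    have hmem : (SemidirectProduct.inl x.left : PiHtχq p i j) ∈
        closure (SemidirectProduct.inl '' Set.range gfpFst) :=
      image_closure_subset_closure_image (Semidirect.continuous_inl (isInducing_leftRightHatχq p i j))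
        ⟨x.left, isProfiniteCompletion_gfpFst.denseRange x.left, rfl⟩
    rw [hxe]
    have key := closure_mono hsub hmem
    rwa [← Subgroup.topologicalClosure_coe] at key

/-- `(x, 1) ∈ Δ_X`. [cite: MochizukiEtTh2009, §1 p.12] -/
theorem inl_mem_deltaHatχq (x : F₂hatT) : (SemidirectProduct.inl x : PiHtχq p i j) ∈ (curveχq p i j).DeltaHat := by
  rw [deltaHatχq_eq, MonoidHom.mem_ker, SemidirectProduct.rightHom_inl]

/-- Elements of `Δ_X` have trivial `G_{ℚ_p}`-component. [cite: MochizukiEtTh2009, §1 p.12] -/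
theorem right_eq_one_of_mem_deltaHatχq {x : PiHtχq p i j} (hx : x ∈ (curveχq p i j).DeltaHat) : x.right = 1 := by
  rw [deltaHatχq_eq, MonoidHom.mem_ker] at hx
  exact hx

/-- `Δ_X` is normal in `Π_X`. [cite: MochizukiEtTh2009, §1 p.12] -/
theorem deltaHatχq_normal : (curveχq p i j).DeltaHat.Normal := by
  rw [deltaHatχq_eq]
  infer_instance

/-- **`Δ_X ≃ₜ* F̂₂`** for the stage-2 model. [cite: MochizukiEtTh2009, §1 p.12] -/
def deltaHatχqEquiv : F₂hatT ≃ₜ* (curveχq p i j).DeltaHat where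
  toFun x := ⟨SemidirectProduct.inl x, inl_mem_deltaHatχq p i j x⟩
  invFun y := (Subtype.val y).left
  left_inv x := rfl
  right_inv y := by
    apply Subtype.ext
    change SemidirectProduct.inl (y.1.left) = y.1
    rw [← SemidirectProduct.inl_left_mul_inr_right y.1, right_eq_one_of_mem_deltaHatχq p i j y.2, map_one,
      mul_one]
    rfl
  map_mul' x y := Subtype.ext (map_mul _ x y)
  continuous_toFun := (Semidirect.continuous_inl (isInducing_leftRightHatχq p i j)).subtype_mk _
  continuous_invFun := (Semidirect.continuous_left (isInducing_leftRightHatχq p i j)).comp continuous_subtype_val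

/-- **`Δ_X` of the stage-2 model is profinite free on two generators** (the affine action changes the Galois
action, not `Δ_X = F̂₂`). [cite: MochizukiEtTh2009, §1 p.12] -/
theorem isFreeProfiniteOnTwo_deltaHatχq : IsFreeProfiniteOnTwo (curveχq p i j).DeltaHat :=
  IsFreeProfiniteOnTwo.of_continuousMulEquiv (deltaHatχqEquiv p i j)
    isFreeProfiniteOnTwo_profiniteCompletion_freeGroup

end Literature.AnabelianGeometry.EtaleTheta.SettingModel

end
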